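import Literature.NumberTheory.Automorphic.OpenCellCompactCoordinates
import Literature.NumberTheory.Automorphic.UnitaryGroupUnipotentLimitCompactOpen
import Literature.NumberTheory.Automorphic.UnitaryGroupCMLocalIwasawa
import Literature.NumberTheory.Automorphic.U3LocalBruhatDecompositionProofs
import Literature.NumberTheory.Automorphic.LocalUnitaryGroupCongrMeasure
import HarnessLib

/-!
# Compact support of the open-cell function on `N(L⁺_v)` for sections of `Ind_B^{U(Φ_N)(L⁺_v)}` vanishing at `1`

Topic `NumberTheory/Automorphic`; namespace `Literature.NumberTheory.Automorphic.UnitaryGroup`.  THEOREMS ONLY: no definition,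
no named fact, no `sorry`, no instance declaration, no notation.  Registry pub/hodgecm-mathlib F0∕P3, T3b statement tree, node
N1 (★ `UnitaryGroup.U3PrincipalSeriesJacquetFiltration`, [Casselman1995, §6.3 and Lemma 7.1.1 (a)]) — the `U(3)` INSTANCE of
★ `SmoothIndCellFunCompactSupport` ∕ ★ `OpenCellCompactCoordinates`: the compact-support input of the UPPER-BOUND half of the
Bruhat filtration of `i_G(χ)|_B` («the open cell contributes at most `dim W`»; consumed by the open-cell transfer into
`C_c^∞(N, W)` and ★ `Representation.finrank_coinvariants_compactlySupported_le`).

## The statements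

`G = U(Φ_N)(L⁺_v) = ↥(unitaryGroupOfForm (c ⊗ 1) (cmLocalForm L N v))` (★ `cmDatum_Local_eq`), `B = (cmBorelTriple L N v).P` its
upper-triangular Borel subgroup, `N = (cmBorelTriple L N v).N`, `τ` ANY representation of `B` (over any commutative ring), `f ∈ Ind_B^G τ`
(★ `Representation.SmoothInd`) with `f(1) = 0`, `w₀ ∈ G`.

* `hasCompactSupport_cellFun_cmBorel` — every `N`, every finite `v`: IF `G ∖ B = B w₀ N` with `B w₀ N ∩ B = ∅` and the
  `N`-coordinate unique, THEN `n ↦ f (w₀ n)` has compact support on `N(L⁺_v)`.  All topological inputs are ★: `G = B · K_v`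
  (★ `exists_borel_mul_mem_cmLocalIntegralLevel`, Iwasawa), `K_v` compact (★ `isCompact_isOpen_cmLocalIntegralLevel`), `B` closed
  (★ `isClosed_borelU`), `N` closed (★ `isClosed_upperUnitriangular`), `G` locally compact second countable (★
  `locallyCompactSpace_local`, `secondCountableTopology_local`) — and ★ `SmoothInd.hasCompactSupport_cellFun_of_sigmaCompact`
  (open mapping theorem; no coordinates, no valuations).
* `hasCompactSupport_cellFun_cmBorel_three` — `N = 3`, `v` NON-SPLIT, `w₀` the element with matrix `Φ₃ = cmLocalForm L 3 v`:
  unconditional, the Bruhat hypotheses being ★ F1 `U3LocalBruhatDecomposition_holds` [Casselman1995, Prop. 1.3.1, 1.3.3].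
* `hasCompactSupport_cellFun_cmPrincipalSeries_three` — the same for `f ∈ i_G(χ)` = ★ `cmPrincipalSeries L 3 v χ` (its carrier IS
  `SmoothInd (cmBorelTriple L 3 v).P (…)`), in the binder shape of ★ `mk_restrict_cmPrincipalSeries_ne_zero_of_cellFun_eq_indicator`.
HC_CM is proved only modulo the printed citations until rung 0 closes; this file discharges no named fact.

## References
* [Casselman1995] W. Casselman, *Introduction to the theory of admissible representations of `p`-adic reductive groups*
  (draft 1 May 1995), Prop. 1.3.1, Prop. 1.3.3, Prop. 6.3.1, Lemma 7.1.1 (a).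
* [BernsteinZelevinsky1977] I. N. Bernstein, A. V. Zelevinsky, *Induced representations of reductive `p`-adic groups. I*,
  Ann. Sci. ÉNS (4) 10 (1977), §5 (proof of Thm. 5.2), §5.14.
* [Rogawski1990] J. D. Rogawski, *Automorphic Representations of Unitary Groups in Three Variables* (1990), §1.10 p. 9, §4.5 p. 45.
-/

set_option autoImplicit false

noncomputable section

open NumberField IsDedekindDomain
open scoped MatrixGroups

namespace Literature.NumberTheory.Automorphic

namespace UnitaryGroup

variable (L : Type) [Field L] [NumberField L] [IsCMField L]

/-- **COMPACT SUPPORT OF THE CELL FUNCTION ON `N(L⁺_v)` — every `N`, every finite place `v`, abstract Bruhat hypotheses**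
([Casselman1995, Prop. 6.3.1]; [BernsteinZelevinsky1977, §5]): for `G = U(Φ_N)(L⁺_v)`, `B` its Borel, `N` the unipotent radical,
`w₀ ∈ G` with (cell) `G ∖ B = B w₀ N`, (disj) `B w₀ N ∩ B = ∅`, (Un) `b w₀ n = w₀ n' ⟹ n = n'`, every `f ∈ Ind_B^G τ` with `f(1) = 0` has
compactly supported cell function `n ↦ f (w₀ n)` on `N`.  Iwasawa, compactness of `K_v`, closedness of `B` and `N`, local compactness
and second countability of `G` are ★; the proof is ★ `SmoothInd.hasCompactSupport_cellFun_of_sigmaCompact` (open mapping theorem).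
[cite: Casselman1995, Prop. 6.3.1] [cite: BernsteinZelevinsky1977, §5.14] -/
theorem hasCompactSupport_cellFun_cmBorel (N : ℕ) (v : HeightOneSpectrum (𝓞 ↥(maximalRealSubfield L)))
    (w₀ : ↥(unitaryGroupOfForm (conjLocal L (IsCMField.complexConj L) v) (cmLocalForm L N v)))
    (hcell : ∀ g : ↥(unitaryGroupOfForm (conjLocal L (IsCMField.complexConj L) v) (cmLocalForm L N v)),
      g ∉ (cmBorelTriple L N v).P → ∃ b ∈ (cmBorelTriple L N v).P, ∃ n : ↥(cmBorelTriple L N v).N, g = b * w₀ * n)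
    (hdisj : ∀ b ∈ (cmBorelTriple L N v).P, ∀ n : ↥(cmBorelTriple L N v).N, b * w₀ * n ∉ (cmBorelTriple L N v).P)
    (hUn : ∀ b ∈ (cmBorelTriple L N v).P, ∀ n n' : ↥(cmBorelTriple L N v).N,
      b * w₀ * n = w₀ * n' → n = n')
    {k : Type*} [CommRing k] {W : Type*} [AddCommGroup W] [Module k W]
    (τ : Representation k ↥(cmBorelTriple L N v).P W)
    (f : Representation.SmoothInd (cmBorelTriple L N v).P τ) (hf : f.toFun 1 = 0) :
    HasCompactSupport fun n : ↥(cmBorelTriple L N v).N => f.toFun (w₀ * n) := by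
  -- topology of `G = U(Φ_N)(L⁺_v)`: locally compact, Hausdorff, second countable (hence `σ`-compact)
  haveI : LocallyCompactSpace ↥(unitaryGroupOfForm (conjLocal L (IsCMField.complexConj L) v) (cmLocalForm L N v)) :=
    locallyCompactSpace_local (IsCMField.complexConj L) N _ v
  haveI : SecondCountableTopology ↥(unitaryGroupOfForm (conjLocal L (IsCMField.complexConj L) v) (cmLocalForm L N v)) :=
    secondCountableTopology_local (IsCMField.complexConj L) N _ v
  -- `B` and `N` are closed, hence `σ`-compact and locally compact
  have hB : IsClosed ((cmBorelTriple L N v).P : Set ↥(unitaryGroupOfForm (conjLocal L (IsCMField.complexConj L) v) (cmLocalForm L N v))) :=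
    isClosed_borelU _ _
  have hN : IsClosed ((cmBorelTriple L N v).N : Set ↥(unitaryGroupOfForm (conjLocal L (IsCMField.complexConj L) v) (cmLocalForm L N v))) :=
    (isClosed_upperUnitriangular (n := N) (R := LocalRing L v)).preimage continuous_subtype_val
  haveI : SigmaCompactSpace ↥(cmBorelTriple L N v).P := hB.sigmaCompactSpace
  haveI : SigmaCompactSpace ↥(cmBorelTriple L N v).N := hN.sigmaCompactSpace
  haveI : LocallyCompactSpace ↥(cmBorelTriple L N v).N := hN.isClosedEmbedding_subtypeVal.locallyCompactSpace
  -- Iwasawa `G = B · K_v` with `K_v = U(Φ_N)(𝒪_v)` compact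
  have hK : IsCompact {κ : ↥(unitaryGroupOfForm (conjLocal L (IsCMField.complexConj L) v) (cmLocalForm L N v)) |
      κ ∈ cmLocalIntegralLevel L N (Matrix.of fun i j : Fin N => if i.val + j.val + 1 = N then (1 : L) else 0) v} :=
    (isCompact_isOpen_cmLocalIntegralLevel L N (Matrix.of fun i j : Fin N => if i.val + j.val + 1 = N then (1 : L) else 0) v).1
  have hIw : ∀ g : ↥(unitaryGroupOfForm (conjLocal L (IsCMField.complexConj L) v) (cmLocalForm L N v)),
      ∃ h ∈ (cmBorelTriple L N v).P,
        ∃ κ ∈ {κ : ↥(unitaryGroupOfForm (conjLocal L (IsCMField.complexConj L) v) (cmLocalForm L N v)) |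
          κ ∈ cmLocalIntegralLevel L N (Matrix.of fun i j : Fin N => if i.val + j.val + 1 = N then (1 : L) else 0) v},
        g = h * κ := by
    intro g
    obtain ⟨h, κ, hκ, hg⟩ := exists_borel_mul_mem_cmLocalIntegralLevel L N v g
    exact ⟨h, h.2, κ, hκ, hg⟩
  exact SmoothInd.hasCompactSupport_cellFun_of_sigmaCompact ((cmBorelTriple L N v).N.subtype) w₀ hB
    continuous_subtype_val hK hIw (fun g hg => hcell g hg) (fun b hb n => hdisj b hb n) (fun b hb n n' h => hUn b hb n n' h) f hf

set_option maxHeartbeats 1600000 in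
/-- **COMPACT SUPPORT OF THE CELL FUNCTION ON `N(L⁺_v)` FOR `U(3)` AT A NON-SPLIT PLACE — unconditional**
([Casselman1995, Prop. 1.3.1, 1.3.3, 6.3.1]): `v` a NON-SPLIT finite place of `L⁺`, `w₀ ∈ U(Φ₃)(L⁺_v)` the element with matrix
`Φ₃` (★ F1 `U3LocalBruhatDecomposition_holds`: `G = B ⊔ B w₀ N`, unique coordinates); then for every representation `τ` of `B`
and every `f ∈ Ind_B^G τ` with `f(1) = 0`, the cell function `n ↦ f (w₀ n)` on `N(L⁺_v)` has compact support.
[cite: Casselman1995, Prop. 1.3.1, Prop. 1.3.3, Prop. 6.3.1] [cite: Rogawski1990, §1.10 p. 9] -/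
theorem hasCompactSupport_cellFun_cmBorel_three (v : HeightOneSpectrum (𝓞 ↥(maximalRealSubfield L)))
    (hv : ∀ w : PlacesOver L v, IsCMField.complexConj L • w.1 = w.1)
    (w₀ : ↥(unitaryGroupOfForm (conjLocal L (IsCMField.complexConj L) v) (cmLocalForm L 3 v)))
    (hw₀ : Units.val (w₀ : GL (Fin 3) (LocalRing L v)) = cmLocalForm L 3 v)
    {k : Type*} [CommRing k] {W : Type*} [AddCommGroup W] [Module k W]
    (τ : Representation k ↥(cmBorelTriple L 3 v).P W)
    (f : Representation.SmoothInd (cmBorelTriple L 3 v).P τ) (hf : f.toFun 1 = 0) :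
    HasCompactSupport fun n : ↥(cmBorelTriple L 3 v).N => f.toFun (w₀ * n) := by
  obtain ⟨w₀', hw₀', hnot, hcells, huniq⟩ := U3LocalBruhatDecomposition_holds L v hv
  have hww : w₀' = w₀ := Subtype.ext (Units.ext (hw₀'.trans hw₀.symm))
  subst hww
  refine hasCompactSupport_cellFun_cmBorel L 3 v w₀' (fun g hg => ?_) (fun b hb n hmem => ?_) (fun b hb n n' h => ?_) τ f hf
  · -- the big cell
    rcases hcells g with hgB | ⟨b, hb, n, hn, hg'⟩
    · exact absurd hgB hg
    · exact ⟨b, hb, ⟨n, hn⟩, hg'⟩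
  · -- the two cells are disjoint: `b w₀ n ∈ B` would put `w₀ = b⁻¹ (b w₀ n) n⁻¹` in `B`
    apply hnot
    have hnB : (n : ↥(unitaryGroupOfForm (conjLocal L (IsCMField.complexConj L) v) (cmLocalForm L 3 v))) ∈
        (cmBorelTriple L 3 v).P := (cmBorelTriple L 3 v).N_le n.2
    have : w₀' = b⁻¹ * (b * w₀' * n) * (n : ↥(unitaryGroupOfForm (conjLocal L (IsCMField.complexConj L) v) (cmLocalForm L 3 v)))⁻¹ := by
      group
    rw [this]
    exact Subgroup.mul_mem _ (Subgroup.mul_mem _ (Subgroup.inv_mem _ hb) hmem) (Subgroup.inv_mem _ hnB)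
  · -- uniqueness of the `N`-coordinate
    have hb' : b ∈ borelU (conjLocal L (IsCMField.complexConj L) v) (cmLocalForm L 3 v) := hb
    have hn : (n : ↥(unitaryGroupOfForm (conjLocal L (IsCMField.complexConj L) v) (cmLocalForm L 3 v))) ∈
        unipotentU (conjLocal L (IsCMField.complexConj L) v) (cmLocalForm L 3 v) := n.2
    have hn' : (n' : ↥(unitaryGroupOfForm (conjLocal L (IsCMField.complexConj L) v) (cmLocalForm L 3 v))) ∈
        unipotentU (conjLocal L (IsCMField.complexConj L) v) (cmLocalForm L 3 v) := n'.2
    have h1 : b * w₀' * (n : ↥(unitaryGroupOfForm (conjLocal L (IsCMField.complexConj L) v) (cmLocalForm L 3 v))) =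
        1 * w₀' * (n' : ↥(unitaryGroupOfForm (conjLocal L (IsCMField.complexConj L) v) (cmLocalForm L 3 v))) := by
      rw [one_mul]; exact h
    have h2 := huniq b hb' 1 (Subgroup.one_mem _)
      (n : ↥(unitaryGroupOfForm (conjLocal L (IsCMField.complexConj L) v) (cmLocalForm L 3 v))) hn
      (n' : ↥(unitaryGroupOfForm (conjLocal L (IsCMField.complexConj L) v) (cmLocalForm L 3 v))) hn' h1
    exact Subtype.ext h2.2

set_option synthInstance.maxHeartbeats 400000 in
set_option maxHeartbeats 1600000 in
/-- **COMPACT SUPPORT OF THE CELL FUNCTION OF `f ∈ i_G(χ)`, `f(1) = 0`, for `U(3)` at a non-split place** (★ `cmPrincipalSeries L 3 v χ`;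
binder shape of ★ `mk_restrict_cmPrincipalSeries_ne_zero_of_cellFun_eq_indicator`): the compact-support input of the UPPER-BOUND
half of N1 («the open cell contributes at most one dimension to `r_B i_G(χ)`», [Casselman1995, Lemma 7.1.1 (a), §6.3]).
[cite: Casselman1995, Lemma 7.1.1 (a) and §6.3] [cite: Rogawski1990, §12.2 p. 173] -/
theorem hasCompactSupport_cellFun_cmPrincipalSeries_three (v : HeightOneSpectrum (𝓞 ↥(maximalRealSubfield L)))
    (hv : ∀ w : PlacesOver L v, IsCMField.complexConj L • w.1 = w.1)
    (χ : ↥(torusU (conjLocal L (IsCMField.complexConj L) v) (cmLocalForm L 3 v)) →* ℂˣ)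
    (w₀ : ↥(unitaryGroupOfForm (conjLocal L (IsCMField.complexConj L) v) (cmLocalForm L 3 v)))
    (hw₀ : Units.val (w₀ : GL (Fin 3) (LocalRing L v)) = cmLocalForm L 3 v) :
    haveI := locallyCompactSpace_cmBorelU L 3 v
    ∀ (f : Representation.SmoothInd (cmBorelTriple L 3 v).P
      (Representation.twist
        (((Representation.trivial ℂ ↥(torusU (conjLocal L (IsCMField.complexConj L) v) (cmLocalForm L 3 v)) ℂ).twist
          χ).comp (cmBorelTriple L 3 v).proj) (rootDeltaChar (cmBorelTriple L 3 v).P))),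
      f.toFun 1 = 0 → HasCompactSupport fun n : ↥(cmBorelTriple L 3 v).N => f.toFun (w₀ * n) := by
  haveI := locallyCompactSpace_cmBorelU L 3 v
  intro f hf
  exact hasCompactSupport_cellFun_cmBorel_three L v hv w₀ hw₀ _ f hf

end UnitaryGroup

end Literature.NumberTheory.Automorphic

end
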